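import Summits.Langlands.Langlands.Theses.DedekindDeficit1951
import Literature.NumberTheory.LFunctions.DedekindZetaERHProofs

/-!
# `DedekindDeficit1951.ZetaNonDivisor` — negative helper: the FALSE-certificate interface

Route `DedekindDeficit1951` (Langlands), crux `ZetaNonDivisor` (stmt-Langlands-17794), refuter lane
(`Theorems/ZetaNonDivisor/Negative/`). The item quantifies over *all* `Z` holomorphic on `{Re s > 0} ∖ {1}`
agreeing with the Dirichlet series `ζ_K` on `Re s > 1`; Hecke's theorem (PROVED in the tree,
`isDedekindZetaContinuation_dedekindZetaCont_holds`) makes `dedekindZetaCont K` such a `Z`, so a zero of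
`dedekindZetaCont K` within `10⁻⁶` of every Riemann zero `s₀` with `0 < Re s₀ < 1`, `|Im s₀| ≤ 200`, for one
admissible field `K` (the Doud–Moore quintic), refutes the item. This is the exact shape a certified census
(or a proof of Dedekind's conjecture `ζ ∣ ζ_K` for this `A₅` quintic up to height `200`) has to deliver;
nothing here decides the item.
-/

set_option linter.dupNamespace false

namespace Summit.Langlands.Langlands.Theorems.ZetaNonDivisor.Negative

open Literature.NumberTheory.LFunctions

/-- **FALSE-certificate interface for `ZetaNonDivisor`.** If some number field `K` of degree `5`
containing a root of the Doud–Moore quintic has, within `10⁻⁶` of every zero `s₀` of `ζ` with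
`0 < Re s₀ < 1` and `|Im s₀| ≤ 200`, a zero of its continued Dedekind zeta function `dedekindZetaCont K`
(Hecke's continuation, holomorphic on `ℂ ∖ {1}` and equal to the Dirichlet series on `Re s > 1`), then
`ZetaNonDivisor` fails: instantiate the item's `∀ Z` at `Z := dedekindZetaCont K`. [folklore] -/
theorem not_zetaNonDivisor_of_nearby_zeros {K : Type} [Field K] [NumberField K]
    (hθ : ∃ θ : K, θ ^ 5 - θ ^ 4 - 780 * θ ^ 3 + 9911 * θ ^ 2 - 24208 * θ + 15952 = 0)
    (hd : Module.finrank ℚ K = 5)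
    (h : ∀ s₀ : ℂ, riemannZeta s₀ = 0 → 0 < s₀.re → s₀.re < 1 → |s₀.im| ≤ 200 →
      ∃ s : ℂ, ‖s - s₀‖ < (1 / 10 ^ 6 : ℝ) ∧ dedekindZetaCont K s = 0) :
    ¬ Theses.DedekindDeficit1951.ZetaNonDivisor := by
  intro hC
  obtain ⟨s₀, hζ, hre₀, hre₁, him, hZ⟩ := hC K hθ hd
  obtain ⟨s, hs, hs0⟩ := h s₀ hζ hre₀ hre₁ him
  refine hZ (dedekindZetaCont K) ?_ ?_ s hs hs0
  · exact (differentiableOn_dedekindZetaCont_holds K).mono fun z hz => hz.2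
  · intro z hz
    exact dedekindZetaCont_eq_dedekindZeta_holds hz

end Summit.Langlands.Langlands.Theorems.ZetaNonDivisor.Negative
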